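/-
Origin: expansion seat `planner-pub-hodgecm-pv11-g5-0`, handover #1 2026-08-18T07:40:45Z (`HOME/pub-hodgecm-pv11-g5/lean/Pv11g5/SeesawTorus.lean`, md5 70a12a09, 871 lines);
landed by the gen-7 packager in gate run 26 as `HodgeCM/PerL34/SeesawTorus.lean` (verbatim).
-/
/-
Origin: HOME/pub-hodgecm-pv11-g5/lean/Pv11g5/SeesawTorus.lean — session planner-pub-hodgecm-pv11-g5-0
(unit pub-hodgecm-pv11-g5, DAG-NODE PROVER #11 gen 5; lineage pv11 = route (E) / N17 seesaw / seam S5, torus side).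
Intended final place (packager's call): `HodgeCM/PerL34/SeesawTorus.lean`.
NEW, ADDITIVE LEAF; imports landed / run-25 tree modules only (`HodgeCM.PerL34.NormOneRelTorusCircles`,
`HodgeCM.PerL34.NormOneRelTorusExtras`, `HodgeCM.PerL34.IdelicTorusDomain`) and Mathlib.
KIND: KERNEL — complete proofs, no new axioms, nothing cited, nothing posited.
-/
import Summits.HodgeConjecture.HodgeCM.PerL34.NormOneRelTorusCircles
import Summits.HodgeConjecture.HodgeCM.PerL34.NormOneRelTorusExtras
import Summits.HodgeConjecture.HodgeCM.PerL34.IdelicTorusDomain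
import Mathlib.MeasureTheory.Measure.Haar.Unique
import Mathlib.Topology.Algebra.PontryaginDual

/-!
# The seesaw torus `T = U(W₁) × U(W₂)` of PerL v5 §3.2 in the idelic model

VERBATIM (PerL v5 `paper.tex`):

* ll. 305–306: "Write `W` for the common hermitian plane, `T := U(W₁)×U(W₂)` and `T′ := U(W₃)×U(W₄)`, maximal
  tori of `U(W)` each canonically isomorphic to `U(1)²`; put `χ₁₂ := χ′₁ ⊠ χ′₂`, `χ₃₄ := χ′₃ ⊠ χ′₄`, and
  `P_{T,χ}(F) := ∫_{[T]} F(t)χ(t) dt` for continuous `F` on `[U(W)]`."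
* l. 335: "… (eq:seesaw) follows by integrating over `[T] = [U(W₁)]×[U(W₂)]` (all integrals over compact sets of
  continuous functions)."
* l. 301 (splitting characters): "unitary Hecke characters of `L` with prescribed components `(z/|z|)^{m_b}` at the
  complex places …"
* Prop. 3.6 Step 2, ll. 423–427: "… the toric periods `P_{T,ξ}(R(h)v)` vanish for every character `ξ` of
  `[T] = T(L₀)\T(𝔸)` with `ξ_∞ = w` and every `h` (for `ξ_∞ ≠ w` they vanish for weight reasons …).
  `(χ′₁,χ′₂) := ξ` is then a pair of automorphic characters of the forced archimedean types, and `(W₁,μ₁,χ′₁)`,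
  `(W₂,μ₂,χ′₂)` with the fixed lines and splitting characters form an allowed pair …"

pv11-g4 (`NormOneRelTorus*.lean`, gate run 25) built ONE factor in the kernel: `U(W_j)(𝔸) = U(1)_{L/L⁺}(𝔸_{L⁺}) =
relNormOneIdeles L⁺ L ≤ 𝔸_L^×`, its rational points `L¹ = relNormOneRat` (discrete, cocompact), the archimedean torus
`U(W_j)(L₀ ⊗ ℝ) = unitaryLineArchTorus L ≃ₜ* ∏_{w∣∞} U(1)` with its place characters `archPlaceChar L w`, and the
embedding `relNormOneInfToIdeles : U(W_j)(L₀⊗ℝ) →* U(W_j)(𝔸)`.  This file assembles PerL's ACTUAL torus `T` of the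
seesaw from two such factors and proves everything Step 2 of Prop. 3.6 uses about it — i.e. it supplies, for the
genuine `T`, the torus-side DATA of pv06-g3's `HodgeCM.PerL34.Annihilation.CompactTorusModelData`
(`CompactTorusModel.lean`, handed for run 26; NOT imported here — the correspondence is by field name):

| `CompactTorusModelData` field | this file |
|---|---|
| `T` + `CommGroup … BorelSpace` | `SeesawTorus K L := relNormOneIdeles K L × relNormOneIdeles K L` (type synonym, Borel σ-algebra) |
| `Λ` + `Countable`, `IsClosed`, `CompactSpace (T ⧸ Λ)`, Borel | `SeesawTorus.rat K L = L¹ × L¹`: `discreteTopology_rat`, `countable_rat`, `isClosed_rat`, `compactSpace_quot` |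
| `νT` + right-invariant, open-positive | `SeesawTorus.haar K L` (a Haar measure; `IsHaarMeasure`) |
| `𝓕`, `isFundamentalDomain`, `measure_lt_top` | `SeesawTorus.fundamentalDomain K L`, `isFundamentalDomain_fundamentalDomain`, `haar_fundamentalDomain_lt_top` |
| `Tc` + compact group, Borel; `μ` probability, left-invariant | `SeesawArchTorus L := unitaryLineArchTorus L × unitaryLineArchTorus L`, `SeesawArchTorus.probHaar L` |
| `ιc`, `ιc_cont` | `SeesawArchTorus.toAdeles L`, `continuous_toAdeles` (and `toAdeles_injective`) |
| `w`, `w_cont`, `w_norm` | `SeesawArchTorus.weight L m₁ m₂ = archWeight L m₁ ⊠ archWeight L m₂`, `continuous_weight`, `norm_weight` |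
| hypothesis of `emb_surj`: `(dualChar ξ).comp cl = w` | `SeesawTorus.weight_comp_archToQuot_iff`: `ξ_∞ = w ⟺ (ξ₁)_∞ = archWeight m₁ ∧ (ξ₂)_∞ = archWeight m₂` |

with `cl = π ∘ ιc = SeesawArchTorus.toQuot L` and `dualChar ξ = Circle.coeHom.comp ξ.toMonoidHom` (pv06-g3's
definition, restated verbatim so that no run-26 file is imported).

Contents.
* §1 `archWeight L m : unitaryLineArchTorus L →* ℂ`, `t ↦ ∏_w ι_w(t_w)^{m_w}` — the archimedean type
  `(z_b/|z_b|)^{m_b}` of l. 301 restricted to the norm-one torus (where `z/|z| = z`): continuous and unitary.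
* §2 the Borel σ-algebra and a Haar measure `du` on `U(W_j)(𝔸) = relNormOneIdeles K L` (registered here by the owner
  lineage, as anticipated in the docstring of pv09-g4's `IdelicTorusDomain.lean`), and a fundamental domain of `L¹`
  of finite Haar measure (pv09-g4 `exists_isFundamentalDomain_relNormOneRat_op`).
* §3 `T(𝔸) = SeesawTorus K L`, `T(L₀) = SeesawTorus.rat K L = L¹ × L¹` (discrete, closed, countable).
* §4 `[T] := T(𝔸)/T(L₀)` is a compact Hausdorff abelian group and **`[T] ≃ₜ* [U(W₁)] × [U(W₂)]`**
  (`SeesawTorus.quotEquiv`, l. 335); its Haar probability measure `dt`.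
* §5 a Haar measure `ν_T` on `T(𝔸)` and a measurable fundamental domain of `T(L₀)` of finite measure, relatively
  compact (pv09-g4 `exists_isFundamentalDomain_op_finite'`, whose hypotheses `DiscreteTopology`, `Countable`,
  `LocallyCompactSpace`, `CompactSpace (T ⧸ Λ)` are §3–§4).
* §6 `T(L₀ ⊗ ℝ) = SeesawArchTorus L` (compact), its probability Haar measure, `ιc = toAdeles` (continuous, injective),
  `cl = toQuot`.
* §7 the typed weight `w = weight L m₁ m₂` (continuous, unitary).
* §8 characters: `PontryaginDual [T] ≃* PontryaginDual [U(W₁)] × PontryaginDual [U(W₂)]` (`SeesawTorus.charEquiv`: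
  "`(χ′₁,χ′₂) := ξ`"), the evaluation formula `ξ(u₁,u₂) = ξ₁(u₁) ξ₂(u₂)` ("`χ₁₂ := χ′₁ ⊠ χ′₂`"), and the type
  statement `weight_comp_archToQuot_iff` ("`ξ_∞ = w` ⟺ `χ′_j` has the forced archimedean type `m_j`", ll. 425–427).

Everything is general in a finite extension `L/K` of number fields (`U(1)_{L/K}`) except §1, §6–§8's weight
statements, which are for the CM extension `L/L⁺` (`K = maximalRealSubfield L`) where `unitaryLineArchTorus` lives.
-/

set_option autoImplicit false

noncomputable section

open MeasureTheory Topology Set Function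

namespace NumberField

/-! ## §1  Typed archimedean weights `t ↦ ∏_w ι_w(t_w)^{m_w}` on `U(W_j)(L₀ ⊗ ℝ)` -/

section ArchWeight

variable (L : Type) [Field L] [NumberField L] [IsCMField L]

/-- The character of `U(W_j)(L₀ ⊗ ℝ) = ∏_{w∣∞} U(1)` of archimedean type `m : (w ∣ ∞) → ℤ`, valued in the unit
circle: `t ↦ ∏_w ι_w(t_w)^{m_w}` (PerL l. 301 "`(z/|z|)^{m_b}`" on the norm-one torus, where `z/|z| = z`). -/
def archWeightCircle (m : InfinitePlace L → ℤ) : unitaryLineArchTorus L →* Circle where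
  toFun t := ∏ w, (archPlaceChars L t w) ^ (m w)
  map_one' := by simp
  map_mul' a b := by
    simp only [map_mul, Pi.mul_apply, mul_zpow, Finset.prod_mul_distrib]

/-- (Ported verbatim from the HodgeCMPerL package; no docstring in the source.) -/
theorem archWeightCircle_apply (m : InfinitePlace L → ℤ) (t : unitaryLineArchTorus L) :
    archWeightCircle L m t = ∏ w, (archPlaceChar L w t) ^ (m w) := rfl

/-- (Ported verbatim from the HodgeCMPerL package; no docstring in the source.) -/
theorem continuous_archWeightCircle (m : InfinitePlace L → ℤ) : Continuous (archWeightCircle L m) := by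
  change Continuous fun t => ∏ w, (archPlaceChars L t w) ^ (m w)
  exact continuous_finsetProd _ fun w _ => ((continuous_apply w).comp (continuous_archPlaceChars L)).zpow (m w)

/-- **The typed archimedean weight** `archWeight L m : U(W_j)(L₀ ⊗ ℝ) →* ℂ`, `t ↦ ∏_w ι_w(t_w)^{m_w}`. -/
def archWeight (m : InfinitePlace L → ℤ) : unitaryLineArchTorus L →* ℂ :=
  Circle.coeHom.comp (archWeightCircle L m)

/-- (Ported verbatim from the HodgeCMPerL package; no docstring in the source.) -/
theorem archWeight_apply (m : InfinitePlace L → ℤ) (t : unitaryLineArchTorus L) :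
    archWeight L m t = ((archWeightCircle L m t : Circle) : ℂ) := rfl

/-- (Ported verbatim from the HodgeCMPerL package; no docstring in the source.) -/
theorem archWeight_eq_prod (m : InfinitePlace L → ℤ) (t : unitaryLineArchTorus L) :
    archWeight L m t = ∏ w, ((archPlaceChar L w t : Circle) : ℂ) ^ (m w) := by
  rw [archWeight, MonoidHom.comp_apply, archWeightCircle_apply, map_prod]
  exact Finset.prod_congr rfl fun w _ => Circle.coe_zpow _ _

/-- The typed weight is unitary … -/
theorem norm_archWeight (m : InfinitePlace L → ℤ) (t : unitaryLineArchTorus L) : ‖archWeight L m t‖ = 1 :=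
  Circle.norm_coe _

/-- … and continuous. -/
theorem continuous_archWeight (m : InfinitePlace L → ℤ) : Continuous (archWeight L m) :=
  continuous_subtype_val.comp (continuous_archWeightCircle L m)

/-- (Ported verbatim from the HodgeCMPerL package; no docstring in the source.) -/
@[simp] theorem archWeight_zero (t : unitaryLineArchTorus L) : archWeight L 0 t = 1 := by
  simp [archWeight_eq_prod]

/-- (Ported verbatim from the HodgeCMPerL package; no docstring in the source.) -/
theorem archWeight_add (m m' : InfinitePlace L → ℤ) (t : unitaryLineArchTorus L) :
    archWeight L (m + m') t = archWeight L m t * archWeight L m' t := by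
  simp only [archWeight_eq_prod, Pi.add_apply, ← Finset.prod_mul_distrib]
  refine Finset.prod_congr rfl fun w _ => ?_
  rw [← Circle.coe_zpow, ← Circle.coe_zpow, ← Circle.coe_zpow, ← Circle.coe_mul, zpow_add]

end ArchWeight

/-! ## §2  The Borel σ-algebra and a Haar measure on `U(W_j)(𝔸) = U(1)_{L/K}(𝔸_K)` -/

section HaarFactor

variable (K L : Type) [Field K] [Field L] [NumberField L] [Algebra K L] [FiniteDimensional K L]

/-- The Borel σ-algebra on `U(1)_{L/K}(𝔸_K)` (registered by the owner lineage of `relNormOneIdeles`; pv09-g4's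
`IdelicTorusDomain.lean` takes it as an instance argument precisely so that this registration is possible). -/
instance measurableSpace_relNormOneIdeles : MeasurableSpace (relNormOneIdeles K L) := borel _

/-- (Ported verbatim from the HodgeCMPerL package; no docstring in the source.) -/
instance borelSpace_relNormOneIdeles : BorelSpace (relNormOneIdeles K L) := ⟨rfl⟩

/-- `du` on `U(W_j)(𝔸)`: a Haar measure on the locally compact abelian group `U(1)_{L/K}(𝔸_K)`. -/
def haarRelNormOneIdeles : Measure (relNormOneIdeles K L) := Measure.haar

/-- (Ported verbatim from the HodgeCMPerL package; no docstring in the source.) -/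
instance isHaarMeasure_haarRelNormOneIdeles : (haarRelNormOneIdeles K L).IsHaarMeasure := by
  unfold haarRelNormOneIdeles; infer_instance

/-- (Ported verbatim from the HodgeCMPerL package; no docstring in the source.) -/
instance isMulRightInvariant_haarRelNormOneIdeles : (haarRelNormOneIdeles K L).IsMulRightInvariant :=
  inferInstance

/-- (Ported verbatim from the HodgeCMPerL package; no docstring in the source.) -/
instance isOpenPosMeasure_haarRelNormOneIdeles : (haarRelNormOneIdeles K L).IsOpenPosMeasure := inferInstance

/-- (Ported verbatim from the HodgeCMPerL package; no docstring in the source.) -/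
instance isFiniteMeasureOnCompacts_haarRelNormOneIdeles : IsFiniteMeasureOnCompacts (haarRelNormOneIdeles K L) :=
  inferInstance

/-- **A fundamental domain of `L¹` in `U(1)(𝔸_K)` of finite Haar measure** (right action `L¹.op`, measurable,
relatively compact) — the set over which "`∫_{[U(W_j)]} … du`" (PerL l. 264) unfolds. -/
theorem exists_isFundamentalDomain_haarRelNormOneIdeles :
    ∃ 𝓕 : Set (relNormOneIdeles K L), MeasurableSet 𝓕 ∧
      IsFundamentalDomain (relNormOneRat K L).op 𝓕 (haarRelNormOneIdeles K L) ∧ IsCompact (closure 𝓕) ∧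
        haarRelNormOneIdeles K L 𝓕 < ⊤ :=
  HodgeCM.PerL34.DiscreteFD.exists_isFundamentalDomain_relNormOneRat_op K L _

/-- `cl_j : U(W_j)(L₀ ⊗ ℝ) → [U(W_j)]`, the archimedean torus of ONE factor mapped to its automorphic quotient. -/
def relNormOneInfToQuot : relNormOneInfUnits K L →* relNormOneIdeles K L ⧸ relNormOneRat K L :=
  (QuotientGroup.mk' (relNormOneRat K L)).comp (relNormOneInfToIdeles K L)

/-- (Ported verbatim from the HodgeCMPerL package; no docstring in the source.) -/
@[simp] theorem relNormOneInfToQuot_apply (t : relNormOneInfUnits K L) :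
    relNormOneInfToQuot K L t = (QuotientGroup.mk (relNormOneInfToIdeles K L t) : _ ⧸ relNormOneRat K L) := rfl

/-- (Ported verbatim from the HodgeCMPerL package; no docstring in the source.) -/
theorem continuous_relNormOneInfToIdeles : Continuous (relNormOneInfToIdeles K L) :=
  ((continuous_infUnitsToIdele L).comp continuous_subtype_val).subtype_mk _

/-- (Ported verbatim from the HodgeCMPerL package; no docstring in the source.) -/
theorem continuous_relNormOneInfToQuot : Continuous (relNormOneInfToQuot K L) :=
  QuotientGroup.continuous_mk.comp (continuous_relNormOneInfToIdeles K L)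

end HaarFactor

/-! ## §3  `T(𝔸) = U(W₁)(𝔸) × U(W₂)(𝔸)` and `T(L₀) = L¹ × L¹` -/

/-- **PerL's seesaw torus, adelic points**: `T(𝔸) := U(W₁)(𝔸) × U(W₂)(𝔸)` for two hermitian lines `W₁, W₂` over
`L/K` (`U(W_j) = U(1)_{L/K}` canonically, l. 306), as a type synonym carrying the product group structure and
topology and the BOREL σ-algebra. -/
def SeesawTorus (K L : Type) [Field K] [Field L] [NumberField L] [Algebra K L] [FiniteDimensional K L] : Type :=
  relNormOneIdeles K L × relNormOneIdeles K L

namespace SeesawTorus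

section Group

variable (K L : Type) [Field K] [Field L] [NumberField L] [Algebra K L] [FiniteDimensional K L]

/-- (Ported verbatim from the HodgeCMPerL package; no docstring in the source.) -/
instance instCommGroup : CommGroup (SeesawTorus K L) :=
  inferInstanceAs (CommGroup (relNormOneIdeles K L × relNormOneIdeles K L))

/-- (Ported verbatim from the HodgeCMPerL package; no docstring in the source.) -/
instance instTopologicalSpace : TopologicalSpace (SeesawTorus K L) :=
  inferInstanceAs (TopologicalSpace (relNormOneIdeles K L × relNormOneIdeles K L))

/-- (Ported verbatim from the HodgeCMPerL package; no docstring in the source.) -/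
instance instIsTopologicalGroup : IsTopologicalGroup (SeesawTorus K L) :=
  inferInstanceAs (IsTopologicalGroup (relNormOneIdeles K L × relNormOneIdeles K L))

/-- (Ported verbatim from the HodgeCMPerL package; no docstring in the source.) -/
instance instT2Space : T2Space (SeesawTorus K L) :=
  inferInstanceAs (T2Space (relNormOneIdeles K L × relNormOneIdeles K L))

/-- (Ported verbatim from the HodgeCMPerL package; no docstring in the source.) -/
instance instLocallyCompactSpace : LocallyCompactSpace (SeesawTorus K L) :=
  inferInstanceAs (LocallyCompactSpace (relNormOneIdeles K L × relNormOneIdeles K L))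

/-- The Borel σ-algebra on `T(𝔸)`. -/
instance instMeasurableSpace : MeasurableSpace (SeesawTorus K L) := borel _

/-- (Ported verbatim from the HodgeCMPerL package; no docstring in the source.) -/
instance instBorelSpace : BorelSpace (SeesawTorus K L) := ⟨rfl⟩

/-- (Ported verbatim from the HodgeCMPerL package; no docstring in the source.) -/
instance instInhabited : Inhabited (SeesawTorus K L) := ⟨1⟩

/-- `(u₁, u₂) ∈ T(𝔸)`. -/
def mk (u₁ u₂ : relNormOneIdeles K L) : SeesawTorus K L := (u₁, u₂)

/-- The projection `T(𝔸) → U(W₁)(𝔸)`. -/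
def fst : SeesawTorus K L →* relNormOneIdeles K L := MonoidHom.fst _ _

/-- The projection `T(𝔸) → U(W₂)(𝔸)`. -/
def snd : SeesawTorus K L →* relNormOneIdeles K L := MonoidHom.snd _ _

/-- The inclusion `U(W₁)(𝔸) → T(𝔸)`, `u ↦ (u, 1)`. -/
def inl : relNormOneIdeles K L →* SeesawTorus K L := MonoidHom.inl _ _

/-- The inclusion `U(W₂)(𝔸) → T(𝔸)`, `u ↦ (1, u)`. -/
def inr : relNormOneIdeles K L →* SeesawTorus K L := MonoidHom.inr _ _

variable {K L}

/-- (Ported verbatim from the HodgeCMPerL package; no docstring in the source.) -/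
@[simp] theorem fst_mk (u₁ u₂ : relNormOneIdeles K L) : fst K L (mk K L u₁ u₂) = u₁ := rfl
/-- (Ported verbatim from the HodgeCMPerL package; no docstring in the source.) -/
@[simp] theorem snd_mk (u₁ u₂ : relNormOneIdeles K L) : snd K L (mk K L u₁ u₂) = u₂ := rfl
/-- (Ported verbatim from the HodgeCMPerL package; no docstring in the source.) -/
@[simp] theorem fst_inl (u : relNormOneIdeles K L) : fst K L (inl K L u) = u := rfl
/-- (Ported verbatim from the HodgeCMPerL package; no docstring in the source.) -/
@[simp] theorem snd_inl (u : relNormOneIdeles K L) : snd K L (inl K L u) = 1 := rfl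
/-- (Ported verbatim from the HodgeCMPerL package; no docstring in the source.) -/
@[simp] theorem fst_inr (u : relNormOneIdeles K L) : fst K L (inr K L u) = 1 := rfl
/-- (Ported verbatim from the HodgeCMPerL package; no docstring in the source.) -/
@[simp] theorem snd_inr (u : relNormOneIdeles K L) : snd K L (inr K L u) = u := rfl

/-- (Ported verbatim from the HodgeCMPerL package; no docstring in the source.) -/
theorem mk_eq_fst_snd (t : SeesawTorus K L) : mk K L (fst K L t) (snd K L t) = t := rfl

/-- (Ported verbatim from the HodgeCMPerL package; no docstring in the source.) -/
theorem inl_mul_inr (u₁ u₂ : relNormOneIdeles K L) : inl K L u₁ * inr K L u₂ = mk K L u₁ u₂ :=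
  Prod.ext (mul_one u₁) (one_mul u₂)

/-- (Ported verbatim from the HodgeCMPerL package; no docstring in the source.) -/
theorem ext {t t' : SeesawTorus K L} (h₁ : fst K L t = fst K L t') (h₂ : snd K L t = snd K L t') : t = t' :=
  Prod.ext h₁ h₂

variable (K L)

/-- (Ported verbatim from the HodgeCMPerL package; no docstring in the source.) -/
theorem continuous_fst : Continuous (fst K L) := _root_.continuous_fst
/-- (Ported verbatim from the HodgeCMPerL package; no docstring in the source.) -/
theorem continuous_snd : Continuous (snd K L) := _root_.continuous_snd
/-- (Ported verbatim from the HodgeCMPerL package; no docstring in the source.) -/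
theorem continuous_inl : Continuous (inl K L) := continuous_id.prodMk continuous_const
/-- (Ported verbatim from the HodgeCMPerL package; no docstring in the source.) -/
theorem continuous_inr : Continuous (inr K L) := continuous_const.prodMk continuous_id

/-- (Ported verbatim from the HodgeCMPerL package; no docstring in the source.) -/
theorem continuous_mk : Continuous fun p : relNormOneIdeles K L × relNormOneIdeles K L => mk K L p.1 p.2 :=
  continuous_id

/-- **`T(L₀) = U(W₁)(L₀) × U(W₂)(L₀) = L¹ × L¹`**, the rational points. -/
def rat : Subgroup (SeesawTorus K L) := (relNormOneRat K L).prod (relNormOneRat K L)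

variable {K L} in
/-- (Ported verbatim from the HodgeCMPerL package; no docstring in the source.) -/
theorem mem_rat_iff (t : SeesawTorus K L) : t ∈ rat K L ↔ fst K L t ∈ relNormOneRat K L ∧ snd K L t ∈ relNormOneRat K L :=
  Iff.rfl

/-- `T(L₀) → L¹ × L¹` (used to transport discreteness and countability). -/
def ratToProd (a : rat K L) : relNormOneRat K L × relNormOneRat K L :=
  (⟨fst K L (a : SeesawTorus K L), a.2.1⟩, ⟨snd K L (a : SeesawTorus K L), a.2.2⟩)

/-- (Ported verbatim from the HodgeCMPerL package; no docstring in the source.) -/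
theorem ratToProd_injective : Injective (ratToProd K L) := by
  intro a b h
  obtain ⟨h1, h2⟩ := Prod.mk.inj h
  exact Subtype.ext (ext (congrArg Subtype.val h1) (congrArg Subtype.val h2))

/-- (Ported verbatim from the HodgeCMPerL package; no docstring in the source.) -/
theorem continuous_ratToProd : Continuous (ratToProd K L) :=
  (((continuous_fst K L).comp continuous_subtype_val).subtype_mk _).prodMk
    (((continuous_snd K L).comp continuous_subtype_val).subtype_mk _)

/-- **`T(L₀)` is discrete in `T(𝔸)`** (from pv11-g4 `discreteTopology_relNormOneRat`). -/
instance discreteTopology_rat : DiscreteTopology (rat K L) :=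
  DiscreteTopology.of_continuous_injective (continuous_ratToProd K L) (ratToProd_injective K L)

/-- `T(L₀)` is countable (from pv09-g4 `countable_relNormOneRat`). -/
instance countable_rat : Countable (rat K L) :=
  (ratToProd_injective K L).countable

/-- `T(L₀)` is closed in `T(𝔸)`. -/
instance isClosed_rat : IsClosed (rat K L : Set (SeesawTorus K L)) := Subgroup.isClosed_of_discrete

end Group

/-! ## §4  The automorphic quotient `[T] = T(L₀)\T(𝔸)` and `[T] ≃ₜ* [U(W₁)] × [U(W₂)]` -/

section Quotient

variable (K L : Type) [Field K] [Field L] [NumberField L] [Algebra K L] [FiniteDimensional K L]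

/-- `[T]` is Hausdorff. -/
instance t2Space_quot : T2Space (SeesawTorus K L ⧸ rat K L) := inferInstance

/-- The Borel σ-algebra on `[T]`. -/
instance measurableSpace_quot : MeasurableSpace (SeesawTorus K L ⧸ rat K L) := borel _

/-- (Ported verbatim from the HodgeCMPerL package; no docstring in the source.) -/
instance borelSpace_quot : BorelSpace (SeesawTorus K L ⧸ rat K L) := ⟨rfl⟩

/-- (Ported verbatim from the HodgeCMPerL package; no docstring in the source.) -/
instance nonempty_quot : Nonempty (SeesawTorus K L ⧸ rat K L) := ⟨1⟩

/-- `[T] → [U(W₁)]`. -/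
def quotFst : SeesawTorus K L ⧸ rat K L →* relNormOneIdeles K L ⧸ relNormOneRat K L :=
  QuotientGroup.map _ _ (fst K L) fun _ ht => ht.1

/-- `[T] → [U(W₂)]`. -/
def quotSnd : SeesawTorus K L ⧸ rat K L →* relNormOneIdeles K L ⧸ relNormOneRat K L :=
  QuotientGroup.map _ _ (snd K L) fun _ ht => ht.2

/-- `[U(W₁)] → [T]`. -/
def quotInl : relNormOneIdeles K L ⧸ relNormOneRat K L →* SeesawTorus K L ⧸ rat K L :=
  QuotientGroup.map _ _ (inl K L) fun _ ha => ⟨ha, one_mem _⟩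

/-- `[U(W₂)] → [T]`. -/
def quotInr : relNormOneIdeles K L ⧸ relNormOneRat K L →* SeesawTorus K L ⧸ rat K L :=
  QuotientGroup.map _ _ (inr K L) fun _ ha => ⟨one_mem _, ha⟩

variable {K L}

/-- (Ported verbatim from the HodgeCMPerL package; no docstring in the source.) -/
@[simp] theorem quotFst_mk (t : SeesawTorus K L) :
    quotFst K L (QuotientGroup.mk t) = QuotientGroup.mk (fst K L t) := rfl
/-- (Ported verbatim from the HodgeCMPerL package; no docstring in the source.) -/
@[simp] theorem quotSnd_mk (t : SeesawTorus K L) :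
    quotSnd K L (QuotientGroup.mk t) = QuotientGroup.mk (snd K L t) := rfl
/-- (Ported verbatim from the HodgeCMPerL package; no docstring in the source.) -/
@[simp] theorem quotInl_mk (u : relNormOneIdeles K L) :
    quotInl K L (QuotientGroup.mk u) = QuotientGroup.mk (inl K L u) := rfl
/-- (Ported verbatim from the HodgeCMPerL package; no docstring in the source.) -/
@[simp] theorem quotInr_mk (u : relNormOneIdeles K L) :
    quotInr K L (QuotientGroup.mk u) = QuotientGroup.mk (inr K L u) := rfl

/-- (Ported verbatim from the HodgeCMPerL package; no docstring in the source.) -/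
@[simp] theorem quotFst_quotInl (q : relNormOneIdeles K L ⧸ relNormOneRat K L) : quotFst K L (quotInl K L q) = q := by
  induction q using QuotientGroup.induction_on; rfl
/-- (Ported verbatim from the HodgeCMPerL package; no docstring in the source.) -/
@[simp] theorem quotSnd_quotInr (q : relNormOneIdeles K L ⧸ relNormOneRat K L) : quotSnd K L (quotInr K L q) = q := by
  induction q using QuotientGroup.induction_on; rfl

-- port_pkg: scope closed for this part
end Quotient
end SeesawTorus
end NumberField
end
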